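import Summits.QuantumFields.YangMills.Theorems.ConvexGribovBodyPoincareToGapKernelVersion
import Summits.QuantumFields.YangMills.Theorems.ConvexGribovBodyPoincareToGapPeelingDecay
import Summits.QuantumFields.YangMills.Theorems.ConvexGribovBodyPoincareToGapClusteringAssembly

/-!
# Two-time arc retention gives volume-uniform time clustering (crux `ConvexGribovBody.PoincareToGap`,
line `Sketch`: the hypothesis-free half of the cyclic peeling, composed)

Torus Wilson state `μ = wilsonMeasure r.ρ β` on `GaugeConfig 4 (2S+1) G` (time = coordinate `0`; for
`s : ZMod (2S+1)` the time OFFSET of a link `e` from `s` is `(e.1 0 - s).val ∈ [0, 2S]`).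

`stub_gapAt_of_twoTimeRetention`: if for ONE `ε ∈ (0, 1]` and all tori `S ≥ S₁` every bounded measurable
gauge-invariant `F` reading only the SPATIAL links of the two end slices (offsets `0` and `ℓ − 1`) of a time
arc of `ℓ` slices (`3 ≤ ℓ`, `ℓ + 3 ≤ 2S + 1`) keeps the fraction `ε` of its variance when the arc is
resampled given its complement — `ε · Var_μ F ≤ ∫ (F − E_μ[F | links at offsets ≥ ℓ])² dμ` (TWO-TIME ARC
RETENTION) — then every pair of gauge-invariant local observables clusters in time at rate `ε/2` on all tori
`S ≥ S₁`, `n ≤ S`: the `UniformLatticeGap` body at this `β`.  This is the composition of the three landed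
stubs of the line: the DLR-kernel versions of `stub_kernelVersion` feed the peeling induction
`stub_peelingDecay` on each torus, and `stub_clusteringAssembly` turns the peeling decay into the clustering
body.  NO Poincaré inequality, transfer matrix, ground state or reflection positivity enters: the statement
isolates exactly what the crux still owes (the registered open cores PB1/PB2 of `Lines/Sketch.lean` imply its
hypothesis via the landed glue p106765 and duality p104460), so that a planner may re-type the crux with this
hypothesis and close it by this theorem.

References: F. Martinelli, *Lectures on Glauber dynamics for discrete spin models*, LNM 1717 (1999), §3
(variance decay by iterated conditional expectations); K. Osterwalder, E. Seiler, Ann. Phys. 110 (1978), §2.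
-/

noncomputable section

open scoped BigOperators Topology
open MeasureTheory ProbabilityTheory Filter
open Literature.MathematicalPhysics.QuantumFieldTheory Literature.MathematicalPhysics.QuantumLattice

namespace Summit.QuantumFields.YangMills.Theorems.PoincareToGap

/-- **Two-time arc retention ⇒ volume-uniform exponential time clustering** (hypothesis-free half of the
cyclic peeling for crux `ConvexGribovBody.PoincareToGap`).  If one `ε ∈ (0, 1]` gives, on every torus
`(2S+1)⁴` with `S ≥ S₁` and for the torus Wilson state `μ = wilsonMeasure r.ρ β`, the retention inequality
`ε · ∫ (F − ∫ F)² dμ ≤ ∫ (F − μ[F | cylinderEvents {e | ℓ ≤ (e.1 0 − s).val}])² dμ` for every arc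
(`s`, `3 ≤ ℓ`, `ℓ + 3 ≤ 2S+1`) and every bounded measurable gauge-invariant `F` reading only the spatial
links at offsets `0` and `ℓ − 1` from `s`, then there are `m = ε/2 > 0` and `S₂ = S₁` such that for all local
gauge-invariant observables `A, B` there is `C` with
`|latticeConnectedCorr r.ρ β (2S+1) A.F B.F n| ≤ C e^{−m n}` for all `S ≥ S₂`, `n ≤ S`.
Proof: `stub_clusteringAssembly` applied to the peeling decay which `stub_peelingDecay` derives on each torus
from the kernel versions of `stub_kernelVersion` and the retention hypothesis. -/
theorem stub_gapAt_of_twoTimeRetention :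
    ∀ (G : Type) [Group G] [TopologicalSpace G] [IsTopologicalGroup G] [CompactSpace G]
      [MeasurableSpace G] [BorelSpace G] (r : LatticeRep G) (β ε : ℝ), 0 < ε → ε ≤ 1 → ∀ S₁ : ℕ,
    (∀ S : ℕ, S₁ ≤ S → ∀ μ : Measure (GaugeConfig 4 (2 * S + 1) G),
      μ = (wilsonMeasure r.ρ β : Measure (GaugeConfig 4 (2 * S + 1) G)) →
      ∀ (s : ZMod (2 * S + 1)) (ℓ : ℕ), 3 ≤ ℓ → ℓ + 3 ≤ 2 * S + 1 →
      ∀ F : GaugeConfig 4 (2 * S + 1) G → ℝ, Measurable F → (∃ M : ℝ, ∀ U, |F U| ≤ M) →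
        IsGaugeInvariant F →
        DependsOn F {e : Edge 4 (2 * S + 1) |
          ((e.1 0 - s).val = 0 ∨ (e.1 0 - s).val = ℓ - 1) ∧ e.2 ≠ 0} →
      ε * ∫ U, (F U - ∫ V, F V ∂μ) ^ 2 ∂μ ≤
        ∫ U, (F U - condExp (cylinderEvents {e : Edge 4 (2 * S + 1) | ℓ ≤ (e.1 0 - s).val}) μ F U) ^ 2 ∂μ) →
    ∃ m : ℝ, 0 < m ∧ ∃ S₂ : ℕ, ∀ A B : YMSpecies G, ∃ C : ℝ, ∀ S n : ℕ, S₂ ≤ S → n ≤ S →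
      |latticeConnectedCorr r.ρ β (2 * S + 1) A.F B.F n| ≤ C * Real.exp (-(m * n)) := by
  intro G _ _ _ _ _ _ r β ε hε0 hε1 S₁ hR
  exact stub_clusteringAssembly G r β ε hε0 hε1 S₁ fun S hS μ hμ =>
    stub_peelingDecay G r β S μ hμ ε hε0 hε1 (stub_kernelVersion G r β S μ hμ) (hR S hS μ hμ)

end Summit.QuantumFields.YangMills.Theorems.PoincareToGap

end
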